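/-
NEW (pub-hodgecm2, COR-CM cell = stage 2 of the Hodge ladder; binder prover b21, row Fg2 of `HOME/BINDER-OWNERS.md`).
Not a port: the FIELD-LEVEL form of the stage-1 derivation `Universe.fact_factorActDescends_of_prodSection`
(`CorCM/Proofs/Pohlmann/FactorActDescent{1,2}.lean`, port of `HodgeCMPerL/HodgeCM/Proofs/Pohlmann/FactorActDescent.lean`
md5 c9f9a7c16261): the same proof text with the record hypothesis `(M : U.ModelAxioms)` replaced by the five fields it
actually reads.  Purpose: the model-side junction `Model.universeOf_fact_factorActDescends_of_rows`
(`CorCM/Model/FactorActDescends.lean`) then has EXACTLY the row type `(universeOf hHD hI hU h₃).Fact_factorActDescends`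
over the displayed binders (count rule R7-2 / C3 of the cell), fed by the landed junction theorems of rows M05, M01, M02,
M10, M15, N1, N3 — independently of the 28-field record (row M22).
-/
import Summits.HodgeConjecture.CorCM.Proofs.Pohlmann.FactorActDescent1
import HarnessLib

/-!
# F2 `Fact_factorActDescends` from five `ModelAxioms` FIELDS (+ N1 + N3 + `Fact_prodSection`)

`Universe.fact_factorActDescends_of_prodSection (M : U.ModelAxioms) …` (part 2 of the port) reads only the fields
M1 `pull_id`, M2 `pull_comp`, M3 `pull_cup`, M18 `lift` and M21 `kunneth1` of `M` (stage-1 numbering; cell rows M05, M01,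
M02, M10, M15).  This file re-runs the SAME argument with those five facts as explicit hypotheses:

* `FieldLevel.exists_eq_sum_pull_prj` / `FieldLevel.exists_eq_sum_prQ` — Künneth in degree one for the iterated product
  (the field-level twin of `Universe.exists_eq_sum_pull_prj` / `exists_eq_sum_prQ` of `Proofs/Pohlmann/WeightSpan.lean`);
* `FieldLevel.pull_comp_pull_eq_id_of_comp_eq_id`, `FieldLevel.pull_eq_of_pull_zero_one`, `FieldLevel.hom_ext_H1`,
  `FieldLevel.exists_isBlockSectionA`, `FieldLevel.exists_isBlockSectionB` — twins of the part-1 lemmas;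
* `FieldLevel.fact_factorActDescends_of_facts : Fact_pull_id → Fact_pull_comp → Fact_pull_cup → Fact_lift →
  Fact_kunneth1 → Fact_cupExterior → Fact_pull_H0 → Fact_prodSection → Fact_factorActDescends` — twin of the part-2
  headline; `Universe.fact_factorActDescends_of_prodSection M` is recovered by feeding `M.pull_id M.pull_comp
  M.pull_cup M.lift M.kunneth1` (`FieldLevel.fact_factorActDescends_of_modelAxioms`, a definitional check that the two forms agree).

The definitions (`Fact_prodSection`, `IsBlockSectionA/B`) and the field-level lemmas `pull_cupPow`,
`pull_succ_eq_of_pull_one_eq`, `natAdd_ne_castAdd`, … of part 1 are reused, not re-declared.  Proof texts are those of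
the port with `M.pull_id ↦ hid`, `M.pull_comp ↦ hcomp`, `M.pull_cup ↦ hcup`, `M.lift ↦ hlift`, `M.kunneth1 ↦ hK`; the
mathematics and its sources are documented in part 1 (Pohlmann 1968 §1; Hartshorne II §3 for the product sections).
-/

noncomputable section

namespace Summit.HodgeConjecture.CorCM

namespace Universe

open Literature.AlgebraicGeometry.Motives (CMType)

variable {U : Universe}

namespace FieldLevel

/-! ### Künneth in degree one for the iterated product, from M1 + M2 + M21 -/

/-- Every rational degree-one class on `∏_{i ≤ n} X_i` is a sum of classes pulled back from the factors
(M21 `kunneth1` + M1 `pull_id` + M2 `pull_comp`, induction on `n`; field-level twin of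
`Universe.exists_eq_sum_pull_prj`). -/
theorem exists_eq_sum_pull_prj (hid : U.Fact_pull_id) (hcomp : U.Fact_pull_comp) (hK : U.Fact_kunneth1) :
    ∀ (n : ℕ) (X : Fin (n + 1) → U.Var) (w : U.Coh (U.prodFin n X) 1),
    ∃ v : (i : Fin (n + 1)) → U.Coh (X i) 1, w = ∑ i, U.pull (U.prj n X i) 1 (v i)
  | 0, X, w => by
    refine ⟨Fin.cons (α := fun i => U.Coh (X i) 1) w (fun i => i.elim0), ?_⟩
    rw [Fin.sum_univ_one, Fin.cons_zero, prj_zero]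
    exact (LinearMap.congr_fun (hid (X 0) 1) w).symm
  | n + 1, X, w => by
    obtain ⟨⟨w', v'⟩, h⟩ := (hK _ _).2 w
    obtain ⟨v, hv⟩ := exists_eq_sum_pull_prj hid hcomp hK n (fun i => X i.castSucc) w'
    refine ⟨Fin.snoc (α := fun i => U.Coh (X i) 1) v v', ?_⟩
    have hcs : ∀ i : Fin (n + 1),
        U.pull (U.prj (n + 1) X i.castSucc) 1 (Fin.snoc (α := fun i => U.Coh (X i) 1) v v' i.castSucc) =
          U.pull (X := U.prodFin (n + 1) X) (U.fst (U.prodFin n fun i => X i.castSucc) (X (Fin.last (n + 1)))) 1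
            (U.pull (U.prj n (fun i => X i.castSucc) i) 1 (v i)) := by
      intro i
      rw [Fin.snoc_castSucc, prj_castSucc, hcomp]
      rfl
    rw [Fin.sum_univ_castSucc, Fin.snoc_last, prj_last, Finset.sum_congr rfl fun i _ => hcs i, ← map_sum, ← hv,
      ← h, LinearMap.coprod_apply]
    rfl

/-- Künneth for `A′ = ∏_j A_{(F,Θ_j)}`: every `w ∈ H¹(A′, ℚ)` is `∑_j pr_j^* v_j` (field-level twin of
`Universe.exists_eq_sum_prQ`). -/
theorem exists_eq_sum_prQ (hid : U.Fact_pull_id) (hcomp : U.Fact_pull_comp) (hK : U.Fact_kunneth1) {F : CMField}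
    {n : ℕ} {Θ : Fin (n + 1) → CMType F} (w : U.Coh (U.cmProd F Θ) 1) :
    ∃ v : (j : Fin (n + 1)) → U.Coh (U.cmAV F (Θ j)) 1, w = ∑ j, U.prQ F Θ j (v j) :=
  exists_eq_sum_pull_prj hid hcomp hK n (fun i => U.cmAV F (Θ i)) w

/-! ### The part-1 lemmas, field-level -/

/-- The section identity on pull-backs: `s^* ∘ pr^* = id` in every degree (M1, M2). -/
theorem pull_comp_pull_eq_id_of_comp_eq_id (hid : U.Fact_pull_id) (hcomp : U.Fact_pull_comp) {X Z : U.Var}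
    (s : U.Mor X Z) (p : U.Mor Z X) (h : U.comp s p = U.idMor X) (k : ℕ) : U.pull s k ∘ₗ U.pull p k = LinearMap.id :=
  (hcomp _ _ _ s p k).symm.trans (((congrArg (fun f => U.pull f k) h)).trans (hid X k))

/-! ### Pull-backs into a CM product are determined in degrees zero and one -/

/-- All degrees at once, for pull-backs INTO a CM product `A′ = ∏_j A_{(F,Θ_j)}` (N1 `Fact_cupExterior`): two
pull-backs agreeing on `H⁰(A′)` and `H¹(A′)` agree. -/
theorem pull_eq_of_pull_zero_one (hcup : U.Fact_pull_cup) (hN1 : U.Fact_cupExterior) {X : U.Var} {F : CMField}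
    {n : ℕ} {Θ : Fin (n + 1) → CMType F} (f g : U.Mor X (U.cmProd F Θ)) (h0 : U.pull f 0 = U.pull g 0)
    (h1 : U.pull f 1 = U.pull g 1) : ∀ k, U.pull f k = U.pull g k
  | 0 => h0
  | k + 1 => pull_succ_eq_of_pull_one_eq hcup (hN1 F n Θ) f g h1 k

/-- Linear maps out of `H¹(A′, ℚ)` are determined by their composites with the `pr_j^*` (Künneth in degree one,
`exists_eq_sum_prQ` / `exists_eq_sum_pull_prj`, from M21). -/
theorem hom_ext_H1 (hid : U.Fact_pull_id) (hcomp : U.Fact_pull_comp) (hK : U.Fact_kunneth1) {F : CMField} {n : ℕ}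
    {Θ : Fin (n + 1) → CMType F} {X : U.Var}
    {φ ψ : U.Coh (U.cmProd F Θ) 1 →ₗ[ℚ] U.Coh X 1}
    (h : ∀ (j : Fin (n + 1)) (y : U.Coh (U.cmAV F (Θ j)) 1),
      φ (U.pull (U.prj n (fun i => U.cmAV F (Θ i)) j) 1 y) = ψ (U.pull (U.prj n (fun i => U.cmAV F (Θ i)) j) 1 y)) :
    φ = ψ := by
  refine LinearMap.ext fun w => ?_
  obtain ⟨v, rfl⟩ := exists_eq_sum_prQ hid hcomp hK w
  rw [map_sum, map_sum]
  exact Finset.sum_congr rfl fun j _ => h j (v j)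

/-! ### Block sections -/

/-- **A section of the first block exists** (`Fact_prodSection` + M1, M2; induction on `m` along the nesting
`P = (⋯((Y × A_{n+1}) × A_{n+2})⋯) × A_{n+m+1}`: compose the sections of the first projections). -/
theorem exists_isBlockSectionA (hid : U.Fact_pull_id) (hcomp : U.Fact_pull_comp) (hS : U.Fact_prodSection) (F : CMField) (n : ℕ) :
    ∀ (m : ℕ) (Ξ : Fin (n + 1 + (m + 1)) → CMType F),
      ∃ t : U.Mor (U.cmProd F (blkA Ξ)) (U.cmProd F Ξ), U.IsBlockSectionA F Ξ t := by
  intro m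
  induction m with
  | zero =>
    intro Ξ
    obtain ⟨⟨s, hs⟩, -⟩ := hS (U.cmProd F (fun k => Ξ (Fin.castSucc k))) (U.cmAV F (Ξ (Fin.last (n + 1))))
    have hs1 := pull_comp_pull_eq_id_of_comp_eq_id hid hcomp s _ hs
    refine ⟨s, fun j k => ?_⟩
    have hc := congrArg (fun f => U.pull f k) (U.prj_castSucc n (fun k => U.cmAV F (Ξ k)) j)
    have hp := hcomp _ _ _
      (U.fst (U.cmProd F (fun k => Ξ (Fin.castSucc k))) (U.cmAV F (Ξ (Fin.last (n + 1)))))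
      (U.prj n (fun i => U.cmAV F (Ξ (Fin.castSucc i))) j) k
    exact (congrArg (fun g => U.pull s k ∘ₗ g) (hc.trans hp)).trans <|
      (LinearMap.comp_assoc _ _ _).symm.trans <|
      (congrArg (fun g => g ∘ₗ U.pull (U.prj n (fun i => U.cmAV F (Ξ (Fin.castSucc i))) j) k) (hs1 k)).trans
        (LinearMap.id_comp _)
  | succ m ih =>
    intro Ξ
    obtain ⟨t', ht'⟩ := ih (fun k => Ξ (Fin.castSucc k))
    obtain ⟨⟨s, hs⟩, -⟩ :=
      hS (U.cmProd F (fun k => Ξ (Fin.castSucc k))) (U.cmAV F (Ξ (Fin.last (n + 1 + m + 1))))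
    have hs1 := pull_comp_pull_eq_id_of_comp_eq_id hid hcomp s _ hs
    refine ⟨U.comp t' s, fun j k => ?_⟩
    have hc := congrArg (fun f => U.pull f k)
      (U.prj_castSucc (n + 1 + m) (fun k => U.cmAV F (Ξ k)) (Fin.castAdd (m + 1) j))
    have hp := hcomp _ _ _
      (U.fst (U.cmProd F (fun k => Ξ (Fin.castSucc k))) (U.cmAV F (Ξ (Fin.last (n + 1 + m + 1)))))
      (U.prj (n + 1 + m) (fun i => U.cmAV F (Ξ (Fin.castSucc i))) (Fin.castAdd (m + 1) j)) k
    have ht := hcomp (U.cmProd F (blkA Ξ)) _ (U.cmProd F Ξ) t' s k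
    rw [ht]
    exact (congrArg (fun g => (U.pull t' k ∘ₗ U.pull s k) ∘ₗ g) (hc.trans hp)).trans <|
      (LinearMap.comp_assoc _ _ _).trans <|
      (congrArg (fun g => U.pull t' k ∘ₗ g) ((LinearMap.comp_assoc _ _ _).symm.trans
        ((congrArg (fun g => g ∘ₗ _) (hs1 k)).trans (LinearMap.id_comp _)))).trans (ht' j k)

/-- **A section of the second block exists** (`Fact_prodSection` + M1, M2, M18; induction on `m`: the base is the
section `A_{n+1} → Y × A_{n+1}` of the second projection, the step extends `u` to `u × id` with M18 `Fact_lift`). -/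
theorem exists_isBlockSectionB (hid : U.Fact_pull_id) (hcomp : U.Fact_pull_comp) (hlift : U.Fact_lift)
    (hS : U.Fact_prodSection) (F : CMField) (n : ℕ) :
    ∀ (m : ℕ) (Ξ : Fin (n + 1 + (m + 1)) → CMType F),
      ∃ u : U.Mor (U.cmProd F (blkB Ξ)) (U.cmProd F Ξ), U.IsBlockSectionB F Ξ u := by
  intro m
  induction m with
  | zero =>
    intro Ξ
    obtain ⟨-, ⟨s, hs⟩⟩ := hS (U.cmProd F (fun k => Ξ (Fin.castSucc k))) (U.cmAV F (Ξ (Fin.last (n + 1))))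
    have hs1 := pull_comp_pull_eq_id_of_comp_eq_id hid hcomp s _ hs
    refine ⟨s, fun i k => ?_⟩
    obtain rfl : i = 0 := Fin.fin_one_eq_zero i
    have g1 := (congrArg (fun f => U.pull f k) (U.prj_zero (fun i => U.cmAV F (blkB Ξ i)))).trans
      (hid _ k)
    have hl := congrArg (fun f => U.pull f k) (U.prj_last n (fun k => U.cmAV F (Ξ k)))
    exact (congrArg (fun g => U.pull s k ∘ₗ g) hl).trans ((hs1 k).trans g1.symm)
  | succ m ih =>
    intro Ξ
    obtain ⟨u', hu'⟩ := ih (fun k => Ξ (Fin.castSucc k))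
    -- pieces: `Y'₀ = ∏_{i ≤ m} A_{natAdd i}` (second block of the truncated family), the new last factor `A_last`,
    -- `P' = ∏_{k ≤ n+1+m} A_k`; `u : Y'₀ × A_last → P' × A_last` is the lift of `(fst ; u', snd)` (M18).
    obtain ⟨u, hu1, hu2⟩ := hlift (U.cmProd F (fun k => Ξ (Fin.castSucc k)))
      (U.cmAV F (Ξ (Fin.last (n + 1 + m + 1)))) (U.cmProd F (blkB Ξ))
      (U.comp (U.fst (U.cmProd F (blkB (fun k => Ξ (Fin.castSucc k)))) (U.cmAV F (Ξ (Fin.last (n + 1 + m + 1)))))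
        u')
      (U.snd (U.cmProd F (blkB (fun k => Ξ (Fin.castSucc k)))) (U.cmAV F (Ξ (Fin.last (n + 1 + m + 1)))))
    have e1 : ∀ k, U.pull u k ∘ₗ U.pull (U.fst (U.cmProd F (fun k => Ξ (Fin.castSucc k)))
        (U.cmAV F (Ξ (Fin.last (n + 1 + m + 1))))) k =
        U.pull (U.fst (U.cmProd F (blkB (fun k => Ξ (Fin.castSucc k)))) (U.cmAV F (Ξ (Fin.last (n + 1 + m + 1)))))
          k ∘ₗ U.pull u' k := fun k =>
      (hcomp _ _ _ u _ k).symm.trans ((congrArg (fun f => U.pull f k) hu1).trans (hcomp _ _ _ _ u' k))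
    have e2 : ∀ k, U.pull u k ∘ₗ U.pull (U.snd (U.cmProd F (fun k => Ξ (Fin.castSucc k)))
        (U.cmAV F (Ξ (Fin.last (n + 1 + m + 1))))) k =
        U.pull (U.snd (U.cmProd F (blkB (fun k => Ξ (Fin.castSucc k)))) (U.cmAV F (Ξ (Fin.last (n + 1 + m + 1)))))
          k := fun k =>
      (hcomp _ _ _ u _ k).symm.trans (congrArg (fun f => U.pull f k) hu2)
    refine ⟨u, fun i k => ?_⟩
    obtain ⟨i, rfl⟩ | rfl := i.eq_castSucc_or_eq_last
    · have hc := congrArg (fun f => U.pull f k)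
        (U.prj_castSucc (n + 1 + m) (fun k => U.cmAV F (Ξ k)) (Fin.natAdd (n + 1) i))
      have hp := hcomp _ _ _
        (U.fst (U.cmProd F (fun k => Ξ (Fin.castSucc k))) (U.cmAV F (Ξ (Fin.last (n + 1 + m + 1)))))
        (U.prj (n + 1 + m) (fun i => U.cmAV F (Ξ (Fin.castSucc i))) (Fin.natAdd (n + 1) i)) k
      have hc' := congrArg (fun f => U.pull f k) (U.prj_castSucc m (fun i => U.cmAV F (blkB Ξ i)) i)
      have hp' := hcomp _ _ _
        (U.fst (U.cmProd F (blkB (fun k => Ξ (Fin.castSucc k)))) (U.cmAV F (Ξ (Fin.last (n + 1 + m + 1)))))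
        (U.prj m (fun i => U.cmAV F (blkB Ξ (Fin.castSucc i))) i) k
      exact (congrArg (fun g => U.pull u k ∘ₗ g) (hc.trans hp)).trans <|
        (LinearMap.comp_assoc _ _ _).symm.trans <|
        (congrArg (fun g => g ∘ₗ _) (e1 k)).trans <|
        (LinearMap.comp_assoc _ _ _).trans <|
        (congrArg (fun g => _ ∘ₗ g) (hu' i k)).trans <| hp'.symm.trans hc'.symm
    · have hl := congrArg (fun f => U.pull f k) (U.prj_last (n + 1 + m) (fun k => U.cmAV F (Ξ k)))
      have hl' := congrArg (fun f => U.pull f k) (U.prj_last m (fun i => U.cmAV F (blkB Ξ i)))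
      exact (congrArg (fun g => U.pull u k ∘ₗ g) hl).trans ((e2 k).trans hl'.symm)

/-! ### F2 from the five fields -/

/-- **F2 = M35 from the five fields M1 `pull_id`, M2 `pull_comp`, M3 `pull_cup`, M18 `lift`, M21 `kunneth1` + N1 +
N3 + `Fact_prodSection`** (field-level twin of `Universe.fact_factorActDescends_of_prodSection`).  `M_A := t ; M ; p_Y` for a block
section `t`; the identities are checked on `H¹` summand by summand (`hom_ext_H1`) and propagated to all positive
degrees by N1 + M3 (`pull_eq_of_pull_zero_one`); degree `0` is N3. -/
theorem fact_factorActDescends_of_facts (hid : U.Fact_pull_id) (hcomp : U.Fact_pull_comp) (hcup : U.Fact_pull_cup)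
    (hlift : U.Fact_lift) (hK : U.Fact_kunneth1) (hN1 : U.Fact_cupExterior) (hN3 : U.Fact_pull_H0)
    (hS : U.Fact_prodSection) : U.Fact_factorActDescends := by
  intro F n m Ξ pA pB hP a Ma
  obtain ⟨t, ht⟩ := exists_isBlockSectionA hid hcomp hS F n m Ξ
  obtain ⟨u, hu⟩ := exists_isBlockSectionB hid hcomp hlift hS F n m Ξ
  -- the data in applied form
  have hPA : ∀ (j : Fin (n + 1)) (k : ℕ) (y : U.Coh (U.cmAV F (blkA Ξ j)) k),
      U.pull pA k (U.pull (U.prj n (fun i => U.cmAV F (blkA Ξ i)) j) k y) =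
        U.pull (U.prj (n + 1 + m) (fun k => U.cmAV F (Ξ k)) (Fin.castAdd (m + 1) j)) k y :=
    fun j k y => LinearMap.congr_fun (hP.1 j k) y
  have hPB : ∀ (i : Fin (m + 1)) (k : ℕ) (y : U.Coh (U.cmAV F (blkB Ξ i)) k),
      U.pull pB k (U.pull (U.prj m (fun i => U.cmAV F (blkB Ξ i)) i) k y) =
        U.pull (U.prj (n + 1 + m) (fun k => U.cmAV F (Ξ k)) (Fin.natAdd (n + 1) i)) k y :=
    fun i k y => LinearMap.congr_fun (hP.2 i k) y
  have htA : ∀ (j : Fin (n + 1)) (k : ℕ) (y : U.Coh (U.cmAV F (blkA Ξ j)) k),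
      U.pull t k (U.pull (U.prj (n + 1 + m) (fun k => U.cmAV F (Ξ k)) (Fin.castAdd (m + 1) j)) k y) =
        U.pull (U.prj n (fun i => U.cmAV F (blkA Ξ i)) j) k y :=
    fun j k y => LinearMap.congr_fun (ht j k) y
  have huB : ∀ (i : Fin (m + 1)) (k : ℕ) (y : U.Coh (U.cmAV F (blkB Ξ i)) k),
      U.pull u k (U.pull (U.prj (n + 1 + m) (fun k => U.cmAV F (Ξ k)) (Fin.natAdd (n + 1) i)) k y) =
        U.pull (U.prj m (fun i => U.cmAV F (blkB Ξ i)) i) k y :=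
    fun i k y => LinearMap.congr_fun (hu i k) y
  refine ⟨fun j hM => ?_, fun i hM => ?_⟩
  · -- the `Y`-block; the factor action in applied form
    have hMj : ∀ y : U.Coh (U.cmAV F (blkA Ξ j)) 1,
        U.pull Ma 1 (U.pull (U.prj (n + 1 + m) (fun k => U.cmAV F (Ξ k)) (Fin.castAdd (m + 1) j)) 1 y) =
          U.pull (U.prj (n + 1 + m) (fun k => U.cmAV F (Ξ k)) (Fin.castAdd (m + 1) j)) 1
            ((U.cmAct F (blkA Ξ j)).ι a y) :=
      fun y => LinearMap.congr_fun hM.1 y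
    have hMj' : ∀ (j' : Fin (n + 1)), j' ≠ j → ∀ y : U.Coh (U.cmAV F (blkA Ξ j')) 1,
        U.pull Ma 1 (U.pull (U.prj (n + 1 + m) (fun k => U.cmAV F (Ξ k)) (Fin.castAdd (m + 1) j')) 1 y) =
          U.pull (U.prj (n + 1 + m) (fun k => U.cmAV F (Ξ k)) (Fin.castAdd (m + 1) j')) 1 y :=
      fun j' hj' y => LinearMap.congr_fun (hM.2 _ (castAdd_ne_castAdd hj')) y
    have hMi : ∀ (i : Fin (m + 1)) (y : U.Coh (U.cmAV F (blkB Ξ i)) 1),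
        U.pull Ma 1 (U.pull (U.prj (n + 1 + m) (fun k => U.cmAV F (Ξ k)) (Fin.natAdd (n + 1) i)) 1 y) =
          U.pull (U.prj (n + 1 + m) (fun k => U.cmAV F (Ξ k)) (Fin.natAdd (n + 1) i)) 1 y :=
      fun i y => LinearMap.congr_fun (hM.2 _ (natAdd_ne_castAdd i j)) y
    -- `M_A := t ; M ; p_Y`
    have hMA : ∀ (k : ℕ) (x : U.Coh (U.cmProd F (blkA Ξ)) k),
        U.pull (U.comp (U.comp t Ma) pA) k x = U.pull t k (U.pull Ma k (U.pull pA k x)) := fun k x => by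
      rw [hcomp, hcomp]; rfl
    have hFA : U.IsFactorAct F (blkA Ξ) j a (U.comp (U.comp t Ma) pA) := by
      refine ⟨LinearMap.ext fun y => ?_, fun j' hj' => LinearMap.ext fun y => ?_⟩
      · show U.pull (U.comp (U.comp t Ma) pA) 1 (U.pull (U.prj n (fun i => U.cmAV F (blkA Ξ i)) j) 1 y) =
          U.pull (U.prj n (fun i => U.cmAV F (blkA Ξ i)) j) 1 ((U.cmAct F (blkA Ξ j)).ι a y)
        rw [hMA, hPA, hMj, htA]
      · show U.pull (U.comp (U.comp t Ma) pA) 1 (U.pull (U.prj n (fun i => U.cmAV F (blkA Ξ i)) j') 1 y) =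
          U.pull (U.prj n (fun i => U.cmAV F (blkA Ξ i)) j') 1 y
        rw [hMA, hPA, hMj' j' hj', htA]
    have hFA1 : ∀ y : U.Coh (U.cmAV F (blkA Ξ j)) 1,
        U.pull (U.comp (U.comp t Ma) pA) 1 (U.pull (U.prj n (fun i => U.cmAV F (blkA Ξ i)) j) 1 y) =
          U.pull (U.prj n (fun i => U.cmAV F (blkA Ξ i)) j) 1 ((U.cmAct F (blkA Ξ j)).ι a y) :=
      fun y => LinearMap.congr_fun hFA.1 y
    have hFA2 : ∀ (j' : Fin (n + 1)), j' ≠ j → ∀ y : U.Coh (U.cmAV F (blkA Ξ j')) 1,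
        U.pull (U.comp (U.comp t Ma) pA) 1 (U.pull (U.prj n (fun i => U.cmAV F (blkA Ξ i)) j') 1 y) =
          U.pull (U.prj n (fun i => U.cmAV F (blkA Ξ i)) j') 1 y :=
      fun j' hj' y => LinearMap.congr_fun (hFA.2 j' hj') y
    refine ⟨⟨U.comp (U.comp t Ma) pA, hFA, fun k => ?_⟩, fun k => ?_⟩
    · -- `M^* ∘ p_Y^* = p_Y^* ∘ M_A^*`: both are pull-backs of morphisms `P → Y`; compare on `H⁰` and `H¹`
      have h0 : U.pull (U.comp Ma pA) 0 = U.pull (U.comp pA (U.comp (U.comp t Ma) pA)) 0 := by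
        rw [hcomp, hcomp _ _ _ pA, hN3 _ Ma, hN3 _ (U.comp (U.comp t Ma) pA), LinearMap.id_comp,
          LinearMap.comp_id]
      have h1 : U.pull (U.comp Ma pA) 1 = U.pull (U.comp pA (U.comp (U.comp t Ma) pA)) 1 := by
        refine hom_ext_H1 hid hcomp hK fun j' y => ?_
        rw [hcomp, hcomp _ _ _ pA]
        simp only [LinearMap.coe_comp, Function.comp_apply]
        by_cases hj' : j' = j
        · subst hj'
          rw [hPA, hMj, hFA1]
          exact (hPA j' 1 _).symm
        · rw [hPA, hMj' j' hj', hFA2 j' hj']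
          exact (hPA j' 1 _).symm
      exact ((hcomp _ _ _ Ma pA k).symm.trans (pull_eq_of_pull_zero_one hcup hN1 _ _ h0 h1 k)).trans
        (hcomp _ _ _ pA _ k)
    · -- `M^* ∘ p_{Y'}^* = p_{Y'}^*`
      have h0 : U.pull (U.comp Ma pB) 0 = U.pull pB 0 := by
        rw [hcomp, hN3 _ Ma, LinearMap.id_comp]
      have h1 : U.pull (U.comp Ma pB) 1 = U.pull pB 1 := by
        refine hom_ext_H1 hid hcomp hK fun i y => ?_
        rw [hcomp]
        simp only [LinearMap.coe_comp, Function.comp_apply]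
        rw [hPB, hMi]
      exact (hcomp _ _ _ Ma pB k).symm.trans (pull_eq_of_pull_zero_one hcup hN1 _ _ h0 h1 k)
  · -- the `Y'`-block, symmetrically with `M_B := u ; M ; p_{Y'}`
    have hMi : ∀ y : U.Coh (U.cmAV F (blkB Ξ i)) 1,
        U.pull Ma 1 (U.pull (U.prj (n + 1 + m) (fun k => U.cmAV F (Ξ k)) (Fin.natAdd (n + 1) i)) 1 y) =
          U.pull (U.prj (n + 1 + m) (fun k => U.cmAV F (Ξ k)) (Fin.natAdd (n + 1) i)) 1
            ((U.cmAct F (blkB Ξ i)).ι a y) :=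
      fun y => LinearMap.congr_fun hM.1 y
    have hMi' : ∀ (i' : Fin (m + 1)), i' ≠ i → ∀ y : U.Coh (U.cmAV F (blkB Ξ i')) 1,
        U.pull Ma 1 (U.pull (U.prj (n + 1 + m) (fun k => U.cmAV F (Ξ k)) (Fin.natAdd (n + 1) i')) 1 y) =
          U.pull (U.prj (n + 1 + m) (fun k => U.cmAV F (Ξ k)) (Fin.natAdd (n + 1) i')) 1 y :=
      fun i' hi' y => LinearMap.congr_fun (hM.2 _ (natAdd_ne_natAdd hi')) y
    have hMj : ∀ (j : Fin (n + 1)) (y : U.Coh (U.cmAV F (blkA Ξ j)) 1),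
        U.pull Ma 1 (U.pull (U.prj (n + 1 + m) (fun k => U.cmAV F (Ξ k)) (Fin.castAdd (m + 1) j)) 1 y) =
          U.pull (U.prj (n + 1 + m) (fun k => U.cmAV F (Ξ k)) (Fin.castAdd (m + 1) j)) 1 y :=
      fun j y => LinearMap.congr_fun (hM.2 _ (natAdd_ne_castAdd i j).symm) y
    have hMB : ∀ (k : ℕ) (x : U.Coh (U.cmProd F (blkB Ξ)) k),
        U.pull (U.comp (U.comp u Ma) pB) k x = U.pull u k (U.pull Ma k (U.pull pB k x)) := fun k x => by
      rw [hcomp, hcomp]; rfl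
    have hFB : U.IsFactorAct F (blkB Ξ) i a (U.comp (U.comp u Ma) pB) := by
      refine ⟨LinearMap.ext fun y => ?_, fun i' hi' => LinearMap.ext fun y => ?_⟩
      · show U.pull (U.comp (U.comp u Ma) pB) 1 (U.pull (U.prj m (fun i => U.cmAV F (blkB Ξ i)) i) 1 y) =
          U.pull (U.prj m (fun i => U.cmAV F (blkB Ξ i)) i) 1 ((U.cmAct F (blkB Ξ i)).ι a y)
        rw [hMB, hPB, hMi, huB]
      · show U.pull (U.comp (U.comp u Ma) pB) 1 (U.pull (U.prj m (fun i => U.cmAV F (blkB Ξ i)) i') 1 y) =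
          U.pull (U.prj m (fun i => U.cmAV F (blkB Ξ i)) i') 1 y
        rw [hMB, hPB, hMi' i' hi', huB]
    have hFB1 : ∀ y : U.Coh (U.cmAV F (blkB Ξ i)) 1,
        U.pull (U.comp (U.comp u Ma) pB) 1 (U.pull (U.prj m (fun i => U.cmAV F (blkB Ξ i)) i) 1 y) =
          U.pull (U.prj m (fun i => U.cmAV F (blkB Ξ i)) i) 1 ((U.cmAct F (blkB Ξ i)).ι a y) :=
      fun y => LinearMap.congr_fun hFB.1 y
    have hFB2 : ∀ (i' : Fin (m + 1)), i' ≠ i → ∀ y : U.Coh (U.cmAV F (blkB Ξ i')) 1,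
        U.pull (U.comp (U.comp u Ma) pB) 1 (U.pull (U.prj m (fun i => U.cmAV F (blkB Ξ i)) i') 1 y) =
          U.pull (U.prj m (fun i => U.cmAV F (blkB Ξ i)) i') 1 y :=
      fun i' hi' y => LinearMap.congr_fun (hFB.2 i' hi') y
    refine ⟨⟨U.comp (U.comp u Ma) pB, hFB, fun k => ?_⟩, fun k => ?_⟩
    · have h0 : U.pull (U.comp Ma pB) 0 = U.pull (U.comp pB (U.comp (U.comp u Ma) pB)) 0 := by
        rw [hcomp, hcomp _ _ _ pB, hN3 _ Ma, hN3 _ (U.comp (U.comp u Ma) pB), LinearMap.id_comp,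
          LinearMap.comp_id]
      have h1 : U.pull (U.comp Ma pB) 1 = U.pull (U.comp pB (U.comp (U.comp u Ma) pB)) 1 := by
        refine hom_ext_H1 hid hcomp hK fun i' y => ?_
        rw [hcomp, hcomp _ _ _ pB]
        simp only [LinearMap.coe_comp, Function.comp_apply]
        by_cases hi' : i' = i
        · subst hi'
          rw [hPB, hMi, hFB1]
          exact (hPB i' 1 _).symm
        · rw [hPB, hMi' i' hi', hFB2 i' hi']
          exact (hPB i' 1 _).symm
      exact ((hcomp _ _ _ Ma pB k).symm.trans (pull_eq_of_pull_zero_one hcup hN1 _ _ h0 h1 k)).trans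
        (hcomp _ _ _ pB _ k)
    · have h0 : U.pull (U.comp Ma pA) 0 = U.pull pA 0 := by
        rw [hcomp, hN3 _ Ma, LinearMap.id_comp]
      have h1 : U.pull (U.comp Ma pA) 1 = U.pull pA 1 := by
        refine hom_ext_H1 hid hcomp hK fun j y => ?_
        rw [hcomp]
        simp only [LinearMap.coe_comp, Function.comp_apply]
        rw [hPA, hMj]
      exact (hcomp _ _ _ Ma pA k).symm.trans (pull_eq_of_pull_zero_one hcup hN1 _ _ h0 h1 k)

/-- The record form of part 2 is the field-level form fed with the five fields of `M` (definitional agreement of the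
two derivations' STATEMENTS; the port's own proof is `Universe.fact_factorActDescends_of_prodSection`). -/
theorem fact_factorActDescends_of_modelAxioms (M : U.ModelAxioms) (hN1 : U.Fact_cupExterior)
    (hN3 : U.Fact_pull_H0) (hS : U.Fact_prodSection) : U.Fact_factorActDescends :=
  fact_factorActDescends_of_facts M.pull_id M.pull_comp M.pull_cup M.lift M.kunneth1 hN1 hN3 hS

end FieldLevel

end Universe

end Summit.HodgeConjecture.CorCM

end
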